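import Summits.BirchSwinnertonDyer.Rank1Residual.O5.FlexNFCaseNKummerUnitThree
import Summits.BirchSwinnertonDyer.Rank1Residual.O5.ThreeTorsionNormalFormFormalCube
import HarnessLib

/-!
# O5 — T30.2/T30.3 + A1 `FlexNFCaseNKummerLawThree` PROVED AS TYPED (`_holds`): the `φ̂`-Kummer image of EVERY
# Case-N flex normal form `y² + 3b·xy + A₃y = x³` over `ℚ₃` (`A₃ ≡ 1 (mod 3)`, `b³ ≠ A₃`) is flat, is the unit line
# when `cellN` says `k = 1`, and is TRIVIAL when `cellN` says `k = 0`
(cell `b2b-bsdres`, team n1011, ROW T-FLEX-KUM file F-N2; seat `b2b-bsdres-n1011-p18` GEN 15, idle rule; theorems only;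
 no typer / o5-r1 / pool file is edited; the `@[conjecture]` tag's retirement on the node is the typer's edit, not this file's)

HONEST FRAMING (cell `b2b-bsdres`, run/shared/lean/b2b/bsd-rank1-residual/, verbatim in every file): the
goal of the cell is to DELETE the COMBINATION-SHAPED residual classes of the Birch–Swinnerton-Dyer formula
for ALL analytic-rank `≤ 1` elliptic curves over `ℚ` — "full BSD formula for every rank `≤ 1` curve in
class `C`" assembled STRICTLY from published theorems — so that the rank-`≤ 1` remainder becomes exactly
the CONSTRUCTION-SHAPED classes, which are TYPED (missing-input `Prop`s), NOT attempted. This is not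
"finishing BSD". Lane CLASS-CLOSURE / O5 (O5 OPEN): research route; census output (P-K19) is EVIDENCE,
never a Literature fact; nothing is booked; no mark of `RESIDUAL-MAP.md` moves. This file: THEOREMS ONLY
(no definition, no named fact, no `@[conjecture]` node, no `sorry`; net named-fact debt `0`).  A `_holds` closes NO
pair and moves NO mark.  Nothing here is about a Selmer group, an `L`-value or a class group: it is `3`-adic algebra
about one cubic equation, read by the O5 lane (o5-r1 GEN 13, T30) as the `φ̂`-Kummer image `δ(P) = y(P)·ℚ₃^{×3}`.

## What is proved (the THIRD conjunct of the node; conjuncts 1–2 are `nfKummerFlat_zero` (typer, from x11b3-p7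
## p309383) and `flexNFCaseNKummerLawThree_unit_half` (F-N1 `O5/FlexNFCaseNKummerUnitThree.lean`, GEN 14))
* `nfKummerTrivial_zero_of_residues`: for `A₃ ≡ 1 (mod 9)` and `b ≡ 1 (mod 3) → m := (3b − 2 − A₃)/9 ≢ 1 (mod 3)`,
  EVERY `ℚ₃`-point `(x, y)` with `x ≠ 0` of `y² + 3b·xy + A₃y = x³` has `y ∈ ℚ₃^{×3}`.  The proof is valuation and
  residue bookkeeping on `y·(y + 3bx + A₃) = x³` alone — NO group law, NO Néron model / component group, NO Tate run
  (T30 §1's step "`E = 3E + E⁰` when `3 ∤ c₃`" is not needed): a non-integral point has `y` a cube by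
  `ThreeTorsionNormalForm.exists_pow_three_eq_of_one_lt_norm` (x11b3-p7, p309913); an integral point reduces mod `3` to
  `(0,0)`, `(0,−1)` or the cusp `(−1,1)` of `ȳ² + ȳ = x̄³` (`zmod3_points`, `decide`); over `(0,0)`:
  `u := y + 3bx + A₃ ≡ A₃ ≡ 1 (mod 9)` is a cube (`±1 + 9ℤ₃ ⊆ ℚ₃^{×3}`, from p308301's
  `exists_pow_three_eq_of_norm_sub_one_le`) and `y = x³/u`; over `(0,−1)`: `y(P)·y(−P) = −x³`; over the cusp, with
  `x = −1 + 3ξ`, `y = 1 + 3η`, o5-r1's expansion `eqnValue_nf_cusp` reads `3(1 − b)(1 + 3η) ≡ 0 (mod 9)` — impossible —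
  when `b ≢ 1 (mod 3)`, and `η² ≡ m (mod 3)` when `b ≡ 1`: `3 ∣ m` (cells I₀*, Iₙ*) forces `3 ∣ η`, i.e. `y ≡ 1 (mod 9)`,
  a cube; `m ≡ 2` (IV, `c₃ = 1`) is a non-square, no point; `m ≡ 1` (IV, `c₃ = 3`) is the excluded `k = 1` cell — so the
  node's "why it might fail: a non-`E⁰` point in an `Iₙ*` cell with `4 ∣ c`" cannot happen (every such point has `y ≡ 1 (9)`).
* `residues_of_cellN_k_eq_zero`: `(cellN b A₃).k = 0` ⟹ exactly those residue conditions (the `w = 2` branch of the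
  fuel-bounded `ord3 64` is detected by `9 ∣ b³ − A₃`, `27 ∤ b³ − A₃`);
* `flexNFCaseNKummerLawThree_trivial_half` and **`flexNFCaseNKummerLawThree_holds : FlexNFCaseNKummerLawThree`** —
  the node EXACTLY AS TYPED (`O5/O5FlatKummerNormalForm.lean` l.297), via F-N1's `flexNFCaseNKummerLawThree_iff_trivial_half`.
Toolkit (namespace `…FlexNormalForm.KummerResidue`, reused by the Case-S file): residue lifts from `PadicInt.toZMod` /
`toZModPow 2`, units by residue, `exists_pow_three_eq_of_sq_eq_one` (`u ≡ ±1 (mod 9) ⇒ u ∈ ℚ₃^{×3}`, converse of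
p308301's `not_exists_pow_three_eq_of_sq_ne_one`), integrality `norm_y_le_one`.
References: H. Cohen, F. Pazuki, Acta Arith. 140 (2009), Def. 1.3 / Prop. 2.2 [CohenPazuki2009ThreeDescent]; E. F. Schaefer,
J. Number Theory 56 (1996), Lemma 3.8 [Schaefer1996]; folklore `ℤ₃^{×3} = ±1 + 9ℤ₃`; o5-r1 GEN 13
`T30-FLAT-KUMMER-NORMAL-FORM.md` §1 (T30.2/T30.3, amendment A1; census P-K19 kit j142073 = EVIDENCE).
-/

noncomputable section

open Padic

namespace Summit.BirchSwinnertonDyer.Rank1Residual.O5.FlexNormalForm.KummerResidue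

/-- `toZMod X = 0 ↔ 3 ∣ X` in `ℤ₃`. [folklore] -/
theorem toZMod_eq_zero_iff_dvd (X : ℤ_[3]) : PadicInt.toZMod X = 0 ↔ (3 : ℤ_[3]) ∣ X := by
  rw [← RingHom.mem_ker, PadicInt.ker_toZMod, PadicInt.maximalIdeal_eq_span_p, Ideal.mem_span_singleton]
  norm_num

/-- Residue lift modulo `3`: if `X ≡ c (mod 3)` then `X = c + 3ξ` for some `ξ ∈ ℤ₃`. [folklore] -/
theorem exists_eq_add_three_mul {X : ℤ_[3]} {c : ℤ} (h : PadicInt.toZMod X = c) :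
    ∃ ξ : ℤ_[3], X = c + 3 * ξ := by
  have h0 : PadicInt.toZMod (X - (c : ℤ_[3])) = 0 := by rw [map_sub, map_intCast, h, sub_self]
  obtain ⟨ξ, hξ⟩ := (toZMod_eq_zero_iff_dvd _).1 h0
  exact ⟨ξ, by linear_combination hξ⟩

/-- `toZModPow 2 X = 0 ↔ 9 ∣ X` in `ℤ₃`. [folklore] -/
theorem toZModPow_two_eq_zero_iff_dvd (X : ℤ_[3]) : PadicInt.toZModPow 2 X = 0 ↔ (9 : ℤ_[3]) ∣ X := by
  rw [← RingHom.mem_ker, PadicInt.ker_toZModPow, Ideal.mem_span_singleton]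
  norm_num

/-- Residue lift modulo `9`: if `X ≡ c (mod 9)` then `X = c + 9ξ` for some `ξ ∈ ℤ₃`. [folklore] -/
theorem exists_eq_add_nine_mul {X : ℤ_[3]} {c : ℤ} (h : PadicInt.toZModPow 2 X = c) :
    ∃ ξ : ℤ_[3], X = c + 9 * ξ := by
  have h0 : PadicInt.toZModPow 2 (X - (c : ℤ_[3])) = 0 := by rw [map_sub, map_intCast, h, sub_self]
  obtain ⟨ξ, hξ⟩ := (toZModPow_two_eq_zero_iff_dvd _).1 h0
  exact ⟨ξ, by linear_combination hξ⟩

/-- A `3`-adic integer with non-zero residue is a unit: `toZMod U ≠ 0 → ‖U‖ = 1`. [folklore] -/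
theorem norm_eq_one_of_toZMod_ne_zero {U : ℤ_[3]} (h : PadicInt.toZMod U ≠ 0) : ‖U‖ = 1 := by
  refine le_antisymm (PadicInt.norm_le_one _) (not_lt.1 fun hlt => h ?_)
  rw [toZMod_eq_zero_iff_dvd]
  exact_mod_cast (PadicInt.norm_lt_one_iff_dvd U).1 hlt

/-- The residues modulo `9` whose square is `1` are `±1`. [folklore] -/
theorem zmod9_sq_eq_one : ∀ t : ZMod 9, t ^ 2 = 1 → t = 1 ∨ t = -1 := by decide

/-- **Cubes by residue: `±1 + 9ℤ₃ ⊆ ℚ₃^{×3}`.** A `3`-adic integer whose residue modulo `9` has square `1`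
(i.e. `u ≡ ±1 (mod 9)`) is a cube in `ℚ₃` (`exists_pow_three_eq_of_norm_sub_one_le`, p308301, applied to `±u`).
The converse for units is `not_exists_pow_three_eq_of_sq_ne_one` (same file). [folklore] -/
theorem exists_pow_three_eq_of_sq_eq_one {u : ℤ_[3]} (h : (PadicInt.toZModPow 2 u) ^ 2 = 1) :
    ∃ w : ℚ_[3], (u : ℚ_[3]) = w ^ 3 := by
  obtain ⟨ε, hε, hu⟩ : ∃ ε : ℤ_[3], (ε = 1 ∨ ε = -1) ∧ PadicInt.toZModPow 2 (ε * u) = 1 := by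
    rcases zmod9_sq_eq_one _ h with h1 | h1
    · exact ⟨1, Or.inl rfl, by rw [one_mul, h1]⟩
    · exact ⟨-1, Or.inr rfl, by rw [map_mul, map_neg, map_one, h1]; ring⟩
  obtain ⟨ξ, hξ⟩ := exists_eq_add_nine_mul (c := 1) (by rw [hu]; norm_num)
  have h9 : ‖((ε * u : ℤ_[3]) : ℚ_[3]) - 1‖ ≤ (3 : ℝ) ^ (-2 : ℤ) := by
    have e : ((ε * u : ℤ_[3]) : ℚ_[3]) - 1 = ((9 * ξ : ℤ_[3]) : ℚ_[3]) := by rw [hξ]; push_cast; ring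
    have hmem : (9 * ξ : ℤ_[3]) ∈ Ideal.span {(3 : ℤ_[3]) ^ 2} :=
      Ideal.mem_span_singleton.2 ⟨ξ, by norm_num⟩
    have := (PadicInt.norm_le_pow_iff_mem_span_pow (9 * ξ) 2).2 (by exact_mod_cast hmem)
    rw [e, ← PadicInt.norm_def]
    exact_mod_cast this
  obtain ⟨w, hw⟩ := ThreeTorsionNormalForm.exists_pow_three_eq_of_norm_sub_one_le h9
  rcases hε with rfl | rfl
  · exact ⟨w, by simpa using hw⟩
  · refine ⟨-w, ?_⟩
    push_cast at hw
    linear_combination -hw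

/-- Integrality of `y`: on `y² + a₁xy + a₃y = x³` over `ℚ₃` with `‖a₁‖, ‖a₃‖ ≤ 1`, `‖x‖ ≤ 1` forces `‖y‖ ≤ 1`
(else `‖y²‖` strictly dominates). [folklore] -/
theorem norm_y_le_one {a₁ a₃ x y : ℚ_[3]} (ha₁ : ‖a₁‖ ≤ 1) (ha₃ : ‖a₃‖ ≤ 1)
    (h : y ^ 2 + a₁ * x * y + a₃ * y = x ^ 3) (hx : ‖x‖ ≤ 1) : ‖y‖ ≤ 1 := by
  by_contra hy
  rw [not_le] at hy
  have hy0 : 0 < ‖y‖ := zero_lt_one.trans hy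
  have hT : ‖a₁ * x + a₃‖ ≤ 1 := by
    refine (Padic.nonarchimedean _ _).trans (max_le ?_ ha₃)
    rw [norm_mul]
    calc ‖a₁‖ * ‖x‖ ≤ 1 * 1 := by gcongr
      _ = 1 := one_mul _
  have hlt : ‖(a₁ * x + a₃) * y‖ < ‖y ^ 2‖ := by
    rw [norm_mul, norm_pow, sq]
    calc ‖a₁ * x + a₃‖ * ‖y‖ ≤ 1 * ‖y‖ := by gcongr
      _ < ‖y‖ * ‖y‖ := by rw [one_mul]; exact lt_mul_of_one_lt_left hy0 hy
  have hsum : ‖y ^ 2 + (a₁ * x + a₃) * y‖ = ‖y‖ ^ 2 := by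
    rw [Padic.add_eq_max_of_ne (ne_of_gt hlt), max_eq_left hlt.le, norm_pow]
  have hx3 : ‖x ^ 3‖ ≤ 1 := by rw [norm_pow]; exact pow_le_one₀ (norm_nonneg _) hx
  have he : y ^ 2 + (a₁ * x + a₃) * y = x ^ 3 := by linear_combination h
  rw [he] at hsum
  nlinarith
/-! ## Finite residue checks -/

/-- The affine points of `ȳ² + ȳ = x̄³` over `𝔽₃` (the reduction of a Case-N flex normal form, cusp `(−1, 1)`):
`(0, 0)`, `(0, −1)` and the cusp. [folklore] -/
theorem zmod3_points : ∀ x y : ZMod 3, y ^ 2 + y = x ^ 3 →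
    (x = 0 ∧ (y = 0 ∨ y = -1)) ∨ (x = -1 ∧ y = 1) := by decide

/-- `t² + 1 ≠ 0` in `𝔽₃` (`−1` is not a square). [folklore] -/
theorem zmod3_sq_add_one_ne_zero : ∀ t : ZMod 3, t ^ 2 + 1 ≠ 0 := by decide

/-- `t² = 0 → t = 0` in `𝔽₃`. [folklore] -/
theorem zmod3_sq_eq_zero : ∀ t : ZMod 3, t ^ 2 = 0 → t = 0 := by decide

/-- In `ℤ/9`: `3·(1 + 3t) ≠ 0` and `6·(1 + 3t) ≠ 0`. [folklore] -/
theorem zmod9_three_mul_ne_zero : ∀ t : ZMod 9, (3 : ZMod 9) * (1 + 3 * t) ≠ 0 ∧ (6 : ZMod 9) * (1 + 3 * t) ≠ 0 := by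
  decide

end Summit.BirchSwinnertonDyer.Rank1Residual.O5.FlexNormalForm.KummerResidue

/-! ## The three residue classes of integral points of a Case-N flex normal form with `A₃ ≡ 1 (mod 9)` -/

namespace Summit.BirchSwinnertonDyer.Rank1Residual.O5.FlexNormalForm

open KummerResidue

section Integral

variable (b A₃ : ℤ) {X Y : ℤ_[3]}

/-- `A₃ ≡ 1 (mod 9)` read in `ZMod 3` and `ZMod 9`. [folklore] -/
private theorem intCast_A₃_eq_one (hA : A₃ % 9 = 1) :
    ((A₃ : ℤ) : ZMod 3) = 1 ∧ ((A₃ : ℤ) : ZMod (3 ^ 2)) = 1 :=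
  ⟨by simpa using (ZMod.intCast_eq_intCast_iff' A₃ 1 3).2 (by omega),
    by simpa using (ZMod.intCast_eq_intCast_iff' A₃ 1 (3 ^ 2)).2 (by norm_num; omega)⟩

/-- **Over `(0, 0)`.** On `Y² + 3b·XY + A₃Y = X³` in `ℤ₃` with `A₃ ≡ 1 (mod 9)`: if `X ≡ Y ≡ 0 (mod 3)`
then `Y` is a cube in `ℚ₃` — `v₃(Y) = 3v₃(X) ≥ 3`, so `U := Y + 3bX + A₃ ≡ A₃ ≡ 1 (mod 9)` is a cube and
`Y = X³/U` (for `X = 0`: `Y = 0`). [folklore] -/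
theorem cube_of_residue_zero_zero (hA : A₃ % 9 = 1)
    (hE : Y ^ 2 + 3 * (b : ℤ_[3]) * X * Y + (A₃ : ℤ_[3]) * Y = X ^ 3)
    (hx : PadicInt.toZMod X = 0) (hy : PadicInt.toZMod Y = 0) : ∃ w : ℚ_[3], (Y : ℚ_[3]) = w ^ 3 := by
  obtain ⟨hA3, hA9⟩ := intCast_A₃_eq_one A₃ hA
  obtain ⟨ξ, hξ⟩ := exists_eq_add_three_mul (c := 0) (by simpa using hx)
  rw [Int.cast_zero, zero_add] at hξ
  set U : ℤ_[3] := Y + 3 * (b : ℤ_[3]) * X + (A₃ : ℤ_[3]) with hU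
  have hYU : Y * U = X ^ 3 := by rw [hU]; linear_combination hE
  have hU3 : PadicInt.toZMod U = 1 := by
    rw [hU]
    simp only [map_add, map_mul, map_intCast, hx, hy, hA3, mul_zero, zero_add]
  have hUn : ‖U‖ = 1 := norm_eq_one_of_toZMod_ne_zero (by rw [hU3]; exact one_ne_zero)
  have hinv : U * U.inv = 1 := PadicInt.mul_inv hUn
  have hY : Y = 27 * (ξ ^ 3 * U.inv) := by
    calc Y = Y * (U * U.inv) := by rw [hinv, mul_one]
      _ = X ^ 3 * U.inv := by rw [← mul_assoc, hYU]
      _ = 27 * (ξ ^ 3 * U.inv) := by rw [hξ]; ring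
  have h27 : (27 : ZMod (3 ^ 2)) = 0 := by decide
  have h9 : (9 : ZMod (3 ^ 2)) = 0 := by decide
  have hY9 : PadicInt.toZModPow 2 Y = 0 := by
    rw [hY, map_mul, map_ofNat, h27, zero_mul]
  have hU9 : PadicInt.toZModPow 2 U = 1 := by
    have e : U = Y + 9 * ((b : ℤ_[3]) * ξ) + (A₃ : ℤ_[3]) := by rw [hU, hξ]; ring
    rw [e, map_add, map_add, map_mul, map_ofNat, h9, zero_mul, add_zero, hY9, zero_add, map_intCast, hA9]
  obtain ⟨c, hc⟩ := exists_pow_three_eq_of_sq_eq_one (u := U) (by rw [hU9, one_pow])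
  have hc0 : c ≠ 0 := by
    rintro rfl
    have hU0 : U = 0 := PadicInt.coe_eq_zero.1 (by rw [hc]; ring)
    rw [hU0, norm_zero] at hUn
    exact zero_ne_one hUn
  have hq : (Y : ℚ_[3]) * (U : ℚ_[3]) = (X : ℚ_[3]) ^ 3 := by
    have := congrArg (fun z : ℤ_[3] => (z : ℚ_[3])) hYU; push_cast at this; exact this
  refine ⟨(X : ℚ_[3]) / c, ?_⟩
  rw [hc] at hq
  rw [div_pow, eq_div_iff (pow_ne_zero _ hc0)]
  linear_combination hq

/-- **Over `(0, −1)`.** Same curve: if `X ≡ 0`, `Y ≡ −1 (mod 3)` and `X ≠ 0` then `Y` is a cube — the negative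
`Y′ = −Y − 3bX − A₃` lies over `(0, 0)` and `Y·Y′ = −X³`. [folklore] -/
theorem cube_of_residue_zero_neg_one (hA : A₃ % 9 = 1)
    (hE : Y ^ 2 + 3 * (b : ℤ_[3]) * X * Y + (A₃ : ℤ_[3]) * Y = X ^ 3) (hX0 : X ≠ 0)
    (hx : PadicInt.toZMod X = 0) (hy : PadicInt.toZMod Y = -1) : ∃ w : ℚ_[3], (Y : ℚ_[3]) = w ^ 3 := by
  obtain ⟨hA3, -⟩ := intCast_A₃_eq_one A₃ hA
  set Y' : ℤ_[3] := -Y - 3 * (b : ℤ_[3]) * X - (A₃ : ℤ_[3]) with hY'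
  have hE' : Y' ^ 2 + 3 * (b : ℤ_[3]) * X * Y' + (A₃ : ℤ_[3]) * Y' = X ^ 3 := by
    rw [hY']; linear_combination hE
  have hy' : PadicInt.toZMod Y' = 0 := by
    rw [hY']
    simp only [map_sub, map_neg, map_mul, map_intCast, hx, hy, hA3, mul_zero, sub_zero]
    ring
  obtain ⟨c, hc⟩ := cube_of_residue_zero_zero b A₃ hA hE' hx hy'
  have hprod : (Y : ℚ_[3]) * (Y' : ℚ_[3]) = -(X : ℚ_[3]) ^ 3 := by
    have hZ : Y * Y' = -X ^ 3 := by rw [hY']; linear_combination -hE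
    have := congrArg (fun z : ℤ_[3] => (z : ℚ_[3])) hZ; push_cast at this; exact this
  have hX0' : (X : ℚ_[3]) ≠ 0 := PadicInt.coe_ne_zero.2 hX0
  have hc0 : c ≠ 0 := by
    rintro rfl
    refine hX0' (pow_eq_zero_iff three_ne_zero |>.1 ?_)
    rw [hc] at hprod; linear_combination hprod
  refine ⟨-(X : ℚ_[3]) / c, ?_⟩
  rw [hc] at hprod
  rw [div_pow, eq_div_iff (pow_ne_zero _ hc0)]
  linear_combination hprod

/-- **Over the cusp `(−1, 1)`.** Same curve, `A₃ ≡ 1 (mod 9)`, and the cell condition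
`b ≡ 1 (mod 3) → m = (3b − 2 − A₃)/9 ≢ 1 (mod 3)`: if `X ≡ −1`, `Y ≡ 1 (mod 3)` then `Y` is a cube.  Writing
`X = −1 + 3ξ`, `Y = 1 + 3η`, the equation is `9η² + (2 − 3b + A₃)(1 + 3η) + 9(b − 1)ξ + 27(ξ² − ξ³ + bξη) = 0`
(`eqnValue_nf_cusp`); for `b ≢ 1` it reads `3(1 − b)(1 + 3η) ≡ 0 (mod 9)` — impossible; for `b ≡ 1` it reads
`η² ≡ m (mod 3)`: `3 ∣ m` forces `3 ∣ η`, i.e. `Y ≡ 1 (mod 9)`, a cube; `m ≡ 2` is a non-square; `m ≡ 1` is excluded. [folklore] -/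
theorem cube_of_residue_cusp (hA : A₃ % 9 = 1) (hm : b % 3 = 1 → ((3 * b - 2 - A₃) / 9) % 3 ≠ 1)
    (hE : Y ^ 2 + 3 * (b : ℤ_[3]) * X * Y + (A₃ : ℤ_[3]) * Y = X ^ 3)
    (hx : PadicInt.toZMod X = -1) (hy : PadicInt.toZMod Y = 1) : ∃ w : ℚ_[3], (Y : ℚ_[3]) = w ^ 3 := by
  obtain ⟨ξ, hξ⟩ := exists_eq_add_three_mul (X := X) (c := -1) (by rw [hx]; push_cast; rfl)
  obtain ⟨η, hη⟩ := exists_eq_add_three_mul (X := Y) (c := 1) (by rw [hy]; push_cast; rfl)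
  push_cast at hξ hη
  have hF : 9 * η ^ 2 + (2 - 3 * (b : ℤ_[3]) + (A₃ : ℤ_[3])) * (1 + 3 * η) + 9 * ((b : ℤ_[3]) - 1) * ξ
      + 27 * (ξ ^ 2 - ξ ^ 3 + (b : ℤ_[3]) * ξ * η) = 0 := by
    rw [hξ, hη] at hE; linear_combination hE
  have h9 : (9 : ZMod (3 ^ 2)) = 0 := by decide
  have h27 : (27 : ZMod (3 ^ 2)) = 0 := by decide
  have h30 : (3 : ZMod 3) = 0 := by decide
  by_cases hb : b % 3 = 1
  · obtain ⟨M, hM⟩ : ∃ M : ℤ, 2 - 3 * b + A₃ = 9 * M := ⟨(2 - 3 * b + A₃) / 9, by omega⟩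
    obtain ⟨k, hk⟩ : ∃ k : ℤ, b - 1 = 3 * k := ⟨(b - 1) / 3, by omega⟩
    have hM' : (2 - 3 * (b : ℤ_[3]) + (A₃ : ℤ_[3])) = 9 * (M : ℤ_[3]) := by exact_mod_cast hM
    have hk' : ((b : ℤ_[3]) - 1) = 3 * (k : ℤ_[3]) := by exact_mod_cast hk
    have hF' : η ^ 2 + (M : ℤ_[3]) * (1 + 3 * η) + 3 * (k : ℤ_[3]) * ξ
        + 3 * (ξ ^ 2 - ξ ^ 3 + (b : ℤ_[3]) * ξ * η) = 0 := by
      rw [hM', hk'] at hF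
      have h9' : (9 : ℤ_[3]) * (η ^ 2 + (M : ℤ_[3]) * (1 + 3 * η) + 3 * (k : ℤ_[3]) * ξ
          + 3 * (ξ ^ 2 - ξ ^ 3 + (b : ℤ_[3]) * ξ * η)) = 0 := by linear_combination hF
      exact (mul_eq_zero.1 h9').resolve_left (by norm_num)
    have h3 : (PadicInt.toZMod η) ^ 2 + (M : ZMod 3) = 0 := by
      have := congrArg PadicInt.toZMod hF'
      simpa only [map_add, map_mul, map_pow, map_ofNat, map_intCast, map_sub, map_one, map_zero, h30, zero_mul,
        mul_zero, add_zero, mul_one] using this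
    by_cases hM3 : M % 3 = 0
    · have hM0 : (M : ZMod 3) = 0 := by simpa using (ZMod.intCast_eq_intCast_iff' M 0 3).2 (by omega)
      rw [hM0, add_zero] at h3
      obtain ⟨η₁, hη₁⟩ := exists_eq_add_three_mul (X := η) (c := 0) (by rw [zmod3_sq_eq_zero _ h3]; push_cast; rfl)
      rw [Int.cast_zero, zero_add] at hη₁
      have hY9 : PadicInt.toZModPow 2 Y = 1 := by
        have e : Y = 1 + 9 * η₁ := by rw [hη, hη₁]; ring
        rw [e, map_add, map_one, map_mul, map_ofNat, h9, zero_mul, add_zero]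
      exact exists_pow_three_eq_of_sq_eq_one (by rw [hY9, one_pow])
    · exfalso
      rcases (show M % 3 = 1 ∨ M % 3 = 2 by omega) with h1 | h2
      · have hM1 : (M : ZMod 3) = 1 := by simpa using (ZMod.intCast_eq_intCast_iff' M 1 3).2 (by omega)
        rw [hM1] at h3
        exact zmod3_sq_add_one_ne_zero _ h3
      · exact hm hb (by omega)
  · exfalso
    have hc : ((2 - 3 * b + A₃ : ℤ) : ZMod (3 ^ 2)) = 3 ∨ ((2 - 3 * b + A₃ : ℤ) : ZMod (3 ^ 2)) = 6 := by
      rcases (show b % 3 = 0 ∨ b % 3 = 2 by omega) with h0 | h2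
      · left; simpa using (ZMod.intCast_eq_intCast_iff' (2 - 3 * b + A₃) 3 (3 ^ 2)).2 (by norm_num; omega)
      · right; simpa using (ZMod.intCast_eq_intCast_iff' (2 - 3 * b + A₃) 6 (3 ^ 2)).2 (by norm_num; omega)
    have hmap : ((2 - 3 * b + A₃ : ℤ) : ZMod (3 ^ 2)) * (1 + 3 * PadicInt.toZModPow 2 η) = 0 := by
      have e : (2 - 3 * (b : ℤ_[3]) + (A₃ : ℤ_[3])) * (1 + 3 * η)
          = 9 * (-(η ^ 2 + ((b : ℤ_[3]) - 1) * ξ + 3 * (ξ ^ 2 - ξ ^ 3 + (b : ℤ_[3]) * ξ * η))) := by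
        linear_combination hF
      have := congrArg (PadicInt.toZModPow 2) e
      rw [map_mul (PadicInt.toZModPow 2) 9, map_ofNat, h9, zero_mul] at this
      simpa only [map_mul, map_add, map_sub, map_ofNat, map_one, map_intCast, Int.cast_sub, Int.cast_add,
        Int.cast_mul, Int.cast_ofNat] using this
    obtain ⟨h3', h6'⟩ := zmod9_three_mul_ne_zero (PadicInt.toZModPow 2 η)
    rcases hc with hc | hc <;> rw [hc] at hmap <;> [exact h3' hmap; exact h6' hmap]

/-! ## The `k = 0` half of T30.2/T30.3 + A1 -/

/-- **The trivial-image half in residue form.** For `A₃ ≡ 1 (mod 9)` and `b` with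
`b ≡ 1 (mod 3) → (3b − 2 − A₃)/9 ≢ 1 (mod 3)`, EVERY `ℚ₃`-point `(x, y)`, `x ≠ 0`, of `y² + 3b·xy + A₃y = x³`
has `y ∈ ℚ₃^{×3}`: non-integral points by `ThreeTorsionNormalForm.exists_pow_three_eq_of_one_lt_norm` (p309913),
integral points by the three residue classes `(0,0)`, `(0,−1)`, `(−1,1)` of `ȳ² + ȳ = x̄³` over `𝔽₃`. [folklore] -/
theorem nfKummerTrivial_zero_of_residues (hA : A₃ % 9 = 1)
    (hm : b % 3 = 1 → ((3 * b - 2 - A₃) / 9) % 3 ≠ 1) : NFKummerTrivial b A₃ 0 := by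
  intro x y hxy hx
  have h : y ^ 2 + 3 * (b : ℚ_[3]) * x * y + ((A₃ : ℤ) : ℚ_[3]) * y = x ^ 3 := by simpa [OnNF] using hxy
  have h3A : ¬ (3 : ℤ) ∣ A₃ := by omega
  have ha₃ : ‖((A₃ : ℤ) : ℚ_[3])‖ = 1 := by
    refine le_antisymm (Padic.norm_int_le_one _) (not_lt.1 fun h' => h3A ?_)
    exact_mod_cast (Padic.norm_intCast_lt_one_iff.1 h')
  have ha₁ : ‖(3 * (b : ℚ_[3]))‖ < 1 := by
    have e : ((3 * b : ℤ) : ℚ_[3]) = 3 * (b : ℚ_[3]) := by push_cast; ring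
    rw [← e, Padic.norm_intCast_lt_one_iff]
    exact ⟨b, by push_cast; ring⟩
  by_cases hx1 : 1 < ‖x‖
  · exact ThreeTorsionNormalForm.exists_pow_three_eq_of_one_lt_norm ha₁ ha₃.le h hx1
  have hx1' : ‖x‖ ≤ 1 := not_lt.1 hx1
  have hy1 : ‖y‖ ≤ 1 := norm_y_le_one ha₁.le ha₃.le h hx1'
  set X : ℤ_[3] := ⟨x, hx1'⟩ with hXd
  set Y : ℤ_[3] := ⟨y, hy1⟩ with hYd
  have hXc : (X : ℚ_[3]) = x := rfl
  have hYc : (Y : ℚ_[3]) = y := rfl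
  have hE : Y ^ 2 + 3 * (b : ℤ_[3]) * X * Y + (A₃ : ℤ_[3]) * Y = X ^ 3 := by
    apply PadicInt.ext
    push_cast
    rw [hXc, hYc]
    exact h
  have hX0 : X ≠ 0 := by
    intro h0
    exact hx (by rw [← hXc, h0, PadicInt.coe_zero])
  obtain ⟨hA3, -⟩ := intCast_A₃_eq_one A₃ hA
  have h30 : (3 : ZMod 3) = 0 := by decide
  have hres : (PadicInt.toZMod Y) ^ 2 + PadicInt.toZMod Y = (PadicInt.toZMod X) ^ 3 := by
    have := congrArg PadicInt.toZMod hE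
    simpa only [map_add, map_mul, map_pow, map_ofNat, map_intCast, hA3, h30, zero_mul, add_zero, one_mul]
      using this
  rw [← hYc]
  rcases zmod3_points _ _ hres with ⟨hx0, hy0 | hy2⟩ | ⟨hx2, hy1''⟩
  · exact cube_of_residue_zero_zero b A₃ hA hE hx0 hy0
  · exact cube_of_residue_zero_neg_one b A₃ hA hE hX0 hx0 hy2
  · exact cube_of_residue_cusp b A₃ hA hm hE hx2 hy1''

end Integral

/-! ## Reading the cell condition off `cellN`, and the node -/

/-- `ord3 64` detects `v₃ = 2`: `9 ∣ x`, `27 ∤ x` ⟹ `ord3 64 x = 2`. [folklore] -/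
theorem ord3_sixtyfour_eq_two {x : ℤ} (h9 : (9 : ℤ) ∣ x) (h27 : ¬ (27 : ℤ) ∣ x) : ord3 64 x = 2 := by
  obtain ⟨n, rfl⟩ := h9
  have hn : n % 3 ≠ 0 := fun h => h27 ⟨n / 3, by omega⟩
  rw [ord3.eq_2, if_pos ⟨by omega, by omega⟩, show (9 * n) / 3 = 3 * n by omega, ord3.eq_2,
    if_pos ⟨by omega, by omega⟩, show (3 * n) / 3 = n by omega, ord3.eq_2, if_neg (by omega)]

/-- In the cell `b ≡ 1 (mod 3)`, `A₃ ≡ 1 (mod 9)`: `3 ∤ m = (3b − 2 − A₃)/9` forces `v₃(b³ − A₃) = 2`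
(`b³ − A₃ = (b − 1)²(b + 2) + 9m` with `27 ∣ (b − 1)²(b + 2)`), so `cellN` is on its `w = 2` branch. [folklore] -/
theorem ord3_cube_sub_eq_two (b A₃ : ℤ) (hb : b % 3 = 1) (h9 : A₃ % 9 = 1)
    (hm : ((3 * b - 2 - A₃) / 9) % 3 ≠ 0) : ord3 64 (b ^ 3 - A₃) = 2 := by
  obtain ⟨k, hk⟩ : ∃ k, b = 3 * k + 1 := ⟨b / 3, by omega⟩
  obtain ⟨m, hm'⟩ : ∃ m, 3 * b - 2 - A₃ = 9 * m := ⟨(3 * b - 2 - A₃) / 9, by omega⟩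
  have hm3 : m % 3 ≠ 0 := by
    have : (3 * b - 2 - A₃) / 9 = m := by omega
    rw [this] at hm; exact hm
  have hX : b ^ 3 - A₃ = 9 * (3 * (k ^ 3 + k ^ 2) + m) := by
    subst hk; linear_combination hm'
  rw [hX]
  exact ord3_sixtyfour_eq_two ⟨_, rfl⟩ (by omega)

/-- **`(cellN b A₃).k = 0` in residues**: `A₃ ≡ 1 (mod 9)`, and on `b ≡ 1 (mod 3)` the cusp parameter
`m = (3b − 2 − A₃)/9` is `≢ 1 (mod 3)` (the `k = 1` cells of Case N are `a₉ ≠ 1` and the IV, `c₃ = 3` cell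
`w = 2 ∧ m ≡ 1`). [folklore] -/
theorem residues_of_cellN_k_eq_zero (b A₃ : ℤ) (hk : (cellN b A₃).k = 0) :
    A₃ % 9 = 1 ∧ (b % 3 = 1 → ((3 * b - 2 - A₃) / 9) % 3 ≠ 1) := by
  have key : b % 3 = 1 → A₃ % 9 = 1 → ¬ ord3 64 (b ^ 3 - A₃) = 2 → ((3 * b - 2 - A₃) / 9) % 3 ≠ 1 :=
    fun hb h9 hw hm1 => hw (ord3_cube_sub_eq_two b A₃ hb h9 (by omega))
  unfold cellN at hk
  simp only at hk
  split_ifs at hk with h1 h2 h3 h4 h5 h6 <;> simp_all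

/-- **The `k = 0` (trivial-image) half of T30.2/T30.3 + A1 `FlexNFCaseNKummerLawThree`, on every Case-N cell.** [folklore] -/
theorem flexNFCaseNKummerLawThree_trivial_half :
    ∀ b A₃ : ℤ, A₃ % 3 = 1 → b ^ 3 ≠ A₃ → ((cellN b A₃).k = 0 → NFKummerTrivial b A₃ 0) := by
  intro b A₃ _ _ hk
  obtain ⟨hA9, hm⟩ := residues_of_cellN_k_eq_zero b A₃ hk
  exact nfKummerTrivial_zero_of_residues b A₃ hA9 hm

/-- **T30.2/T30.3 + A1 `FlexNFCaseNKummerLawThree` PROVED AS TYPED.**  For all `b, A₃ ∈ ℤ` with `A₃ ≡ 1 (mod 3)` and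
`b³ ≠ A₃`, the Kummer image of `y² + 3b·xy + A₃y = x³` over `ℚ₃` is flat (`nfKummerFlat_zero`), contains a unit class
when `(cellN b A₃).k = 1` (F-N1 `flexNFCaseNKummerLawThree_unit_half`), and is trivial when `(cellN b A₃).k = 0`
(`flexNFCaseNKummerLawThree_trivial_half`).  A `_holds` for an O5 `@[conjecture]` node; closes no pair, moves no mark;
census P-K19 stays EVIDENCE.
[cite: CohenPazuki2009ThreeDescent, Def. 1.3 and Prop. 2.2 (arXiv:0903.4963 pp. 4–5)] [cite: Schaefer1996, Lemma 3.8] -/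
theorem flexNFCaseNKummerLawThree_holds : FlexNFCaseNKummerLawThree :=
  flexNFCaseNKummerLawThree_iff_trivial_half.2 flexNFCaseNKummerLawThree_trivial_half

end Summit.BirchSwinnertonDyer.Rank1Residual.O5.FlexNormalForm

end
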